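import Literature.NumberTheory.EllipticCurves.IwasawaTwistModPShapiro
import Literature.NumberTheory.EllipticCurves.Kato2004.IwasawaH1ReductionSeparated
import Literature.NumberTheory.EllipticCurves.TateModuleProjSurjectiveProofs
import Literature.NumberTheory.GaloisRepresentations.DiscreteModuleInverseLimitH1
import HarnessLib

/-!
# Kato 2004 (Astérisque 295) §13.8 / §14.14: the `Λ`-adic coefficient module
# `𝕋 = T_pW ⊗ ℤ_p⟦Γ⟧ = lim←_{n,k} W[p^k] ⊗ ℤ[Gal(ℚ_n/ℚ)]` as an inverse system of FINITE discrete
# `Γ_ℚ`-modules, its shift `T = γ − 1`, and its projections to the Tate module (definitions)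

Topic `NumberTheory/EllipticCurves`, sub-directory `Kato2004` (namespace = path, sub-namespace
`TwistTate`).  Cell `bsd-potss`, seat `bsd-potss-rkm` (g8), crux M = item stmt-BirchSwinnertonDyer-19196:
the OBJECT through which Kato's exact sequence (14.14.1)
`0 → 𝐇¹(T)/a𝐇¹(T) → H¹(ℤ[1/p], T) → _a𝐇²(T) → 0` [p. 243] is proved on the tree's PINNED
`𝐇¹_Γ(T_pW)` (`Kato2004.IwasawaH1Data`, clause `ι_injective` of `Kato2004.MemberHullInputs`):
"`H^q(ℤ[ζ_{p^n}, 1/p], T) ≅ H^q(ℤ[1/p], T ⊗_{O_λ} O_λ[G_n])` where `Gal(ℚ̄/ℚ)` acts on the tensor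
product … by `σ ⊗ σ_n⁻¹` … Hence `𝐇^q(T) = lim←_n H^q(ℤ[1/p], T ⊗ O_λ[G_n])`" [§13.8, p. 228], and the
long exact sequence of `0 → T ⊗ Λ →(a) T ⊗ Λ → T → 0` [§14.14, p. 243].  DEFINITIONS WITH BODIES and
unfolding lemmas only; nothing is asserted (D-0026); no named fact; no instance; no notation.

## The objects (for an elliptic `W/ℚ`, a prime `p`, a `ℤ_p`-extension `κ : ZpExtension ℚ p`,
## `Γ_n = κ.layerSubgroup n = Gal(ℚ̄/ℚ_n)`, `κ̄_n : Γ_ℚ → ℤ/p^n` = `κ.layerIndex n`)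

* `TwistTate.fiberSum h y` (`h : n ≤ m`, `y : ℤ/p^m → A`): the fibre sums
  `c ↦ Σ_{c' ↦ c} y c'` along `ℤ/p^m ↠ ℤ/p^n` — the projection `A ⊗ ℤ[G_m] → A ⊗ ℤ[G_n]` of group
  rings (functorial: `fiberSum_refl`, `fiberSum_fiberSum`; compatible with translations,
  `fiberSum_sub_const`; with `Pi.single`, `fiberSum_single`).
* `TwistTate.torsionPowReduce W p h` (`h : k ≤ k'`): `W[p^{k'}] → W[p^k]`, `P ↦ p^{k'−k} P` — the
  transition of the Tate tower `T_pW = lim←_k W[p^k]` (Silverman *AEC* III.§7).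
* `TwistTate.Coeff W p (n, k) := ℤ/p^n → W[p^k]` — the carrier of the tree's group-ring model
  `κ.twistGroupRing (W.torsionGaloisModule (p^k)) n` (`IwasawaTwistModPShapiro.lean`: `W[p^k] ⊗ ℤ[G_n]`
  with the DIAGONAL action `(g·y)(c) = g·y(c − κ̄_n g)` — Kato's "`σ ⊗ σ_n⁻¹`"), and
  `TwistTate.red W p h : Coeff b →+ Coeff a` for `a ≤ b` in `ℕ × ℕ` (fibre sums in `n`, `p`-power
  multiplication in `k`).
* **`TwistTate.system W p κ : DiscreteInvSystem Γ_ℚ (Coeff W p)`** (the tree's inverse systems of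
  discrete modules, `DiscreteModuleInverseLimit.lean`, index type `ℕ × ℕ` with the product order) and
  its limit **`𝕋 := (system W p κ).limitRep`**, a jointly continuous representation of `Γ_ℚ` on the
  closed subgroup `(system W p κ).limit ⊂ ∏_{n,k} (ℤ/p^n → W[p^k])` — Kato's `T ⊗ Λ` for `T = T_pW`,
  `Λ = ℤ_p⟦Γ⟧`, along the layers of `κ`.
* `TwistTate.shiftCoeff` / **`TwistTate.shift W p κ : limit →+ limit`**: translation `y ↦ y(· + 1)`
  of the group-ring coordinate — multiplication by `γ` (`γ̄ = 1 ∈ ℤ/p^n` for a topological generator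
  with `κ̄_n(γ) = 1`); `Γ_ℚ`-equivariant and continuous; `T := shift − 1` is Kato's `a = γ − 1`
  (the generator of the augmentation ideal `𝔭`, §14.14).
* **`TwistTate.toTate W p κ n : limit →+ T_pW`**, `μ ↦ (μ_{n,k}(0))_k` — evaluation of the `n`-th
  group-ring component at the identity coset (the Shapiro evaluation `Maps_{Γ_n}(Γ_ℚ, T) → T`,
  `f ↦ f(1)`); it is continuous and `Γ_n`-equivariant, and `toTate 0` is the augmentation
  `T ⊗ Λ → T ⊗ Λ/𝔭 = T`.
* **`TwistTate.ofTate W p κ : T_pW →+ limit`**, `a ↦ (a_k · δ_0)_{n,k}` — the unit section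
  (`toTate n ∘ ofTate = id`), `Γ_∞`-equivariant on the nose and used for the surjectivity of the
  augmentation and for lifting invariants.

The THEOREMS about these objects (exactness of `0 → 𝕋 →(shift − 1) 𝕋 →(toTate 0) T_pW → 0`,
compactness, the Shapiro bookkeeping `H¹(Γ_ℚ, Coeff (n,k)) ↔ H¹(ℚ_n, W[p^k])`, and Kato's (14.14.1)
left exactness on the pin) are in the companion `Proofs` files
`Kato2004/IwasawaTwistTateExactProofs.lean`, `…ShapiroProofs.lean`, `…/IwasawaH1ProjZeroKernelProofs.lean`.

## References

* K. Kato, *p-adic Hodge theory and values of zeta functions of modular forms*, Astérisque 295 (2004),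
  §13.8 (p. 228), §14.14 (14.14.1)–(14.14.2) (p. 243). [Kato2004Asterisque]
* J.-P. Serre, *Galois Cohomology* (1997), I §2.5 (induced modules `A ⊗ ℤ[G/H]`). [SerreGaloisCohomology1997]
* B. Mazur, K. Rubin, *Kolyvagin systems*, Mem. AMS 799 (2004), §5.3 (`T ⊗ Λ`). [MazurRubin2004]
* J. H. Silverman, *The Arithmetic of Elliptic Curves* (2009), III.§7 (`T_ℓ E = lim← E[ℓ^n]`). [SilvermanAEC2009]
* Tree: `IwasawaTwistModPShapiro.lean` (`twistGroupRing`, `layerIndex`), `DiscreteModuleInverseLimit*.lean`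
  (`DiscreteInvSystem`, `limitRep`), `TateModule.lean`, `Kato2004/IwasawaH1ReductionPk.lean` (`tateModPk`).
-/

noncomputable section

open scoped Topology
open Field Filter CategoryTheory Finset
open Literature.NumberTheory.GaloisRepresentations
open Literature.NumberTheory.EllipticCurves
open WeierstrassCurve (geomPoints geomTorsion)

namespace Literature.NumberTheory.EllipticCurves.Kato2004

namespace TwistTate

/-! ## Fibre sums along `ℤ/p^m ↠ ℤ/p^n` -/

section FiberSum

variable {p : ℕ} [Fact p.Prime] {A : Type*} [AddCommMonoid A]

/-- The reduction `ℤ/p^m → ℤ/p^n` for `n ≤ m` (Mathlib's `ZMod.castHom` along `p^n ∣ p^m`).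
[cite: SerreGaloisCohomology1997, I §2.5] -/
abbrev castLE {n m : ℕ} (h : n ≤ m) : ZMod (p ^ m) →+* ZMod (p ^ n) :=
  ZMod.castHom (pow_dvd_pow p h) (ZMod (p ^ n))

/-- **Fibre sums** along `ℤ/p^m ↠ ℤ/p^n` (`n ≤ m`): `(fiberSum h y)(c) = Σ_{c' ↦ c} y(c')` — the
projection `A ⊗ ℤ[G_m] → A ⊗ ℤ[G_n]` of group rings (`G_n = ℤ/p^n`), written with an indicator.
[cite: SerreGaloisCohomology1997, I §2.5] -/
def fiberSum {n m : ℕ} (h : n ≤ m) (y : ZMod (p ^ m) → A) (c : ZMod (p ^ n)) : A :=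
  ∑ c' : ZMod (p ^ m), if castLE h c' = c then y c' else 0

/-- Unfolding `fiberSum`. [cite: SerreGaloisCohomology1997, I §2.5] -/
theorem fiberSum_apply {n m : ℕ} (h : n ≤ m) (y : ZMod (p ^ m) → A) (c : ZMod (p ^ n)) :
    fiberSum h y c = ∑ c' : ZMod (p ^ m), if castLE h c' = c then y c' else 0 := rfl

/-- `fiberSum` is additive. [cite: SerreGaloisCohomology1997, I §2.5] -/
theorem fiberSum_add {n m : ℕ} (h : n ≤ m) (y y' : ZMod (p ^ m) → A) :
    fiberSum h (y + y') = fiberSum h y + fiberSum h y' := by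
  funext c
  simp only [fiberSum_apply, Pi.add_apply, ← sum_add_distrib]
  refine sum_congr rfl fun c' _ => ?_
  split_ifs <;> simp

/-- `fiberSum` of `0`. [cite: SerreGaloisCohomology1997, I §2.5] -/
@[simp] theorem fiberSum_zero {n m : ℕ} (h : n ≤ m) : fiberSum h (0 : ZMod (p ^ m) → A) = 0 := by
  funext c
  simp [fiberSum_apply]

/-- `fiberSum` along the identity is the identity. [cite: SerreGaloisCohomology1997, I §2.5] -/
@[simp] theorem fiberSum_refl (n : ℕ) (y : ZMod (p ^ n) → A) : fiberSum le_rfl y = y := by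
  funext c
  rw [fiberSum_apply]
  have hc : ∀ c' : ZMod (p ^ n), castLE (le_refl n) c' = c' := fun c' => by
    rw [castLE, ZMod.castHom_self]; rfl
  simp_rw [hc]
  rw [sum_ite_eq' univ c, if_pos (mem_univ c)]

omit [Fact p.Prime] in
/-- The reductions compose: `ℤ/p^c → ℤ/p^b → ℤ/p^a`. [cite: SerreGaloisCohomology1997, I §2.5] -/
theorem castLE_castLE {a b c : ℕ} (h₁ : a ≤ b) (h₂ : b ≤ c) (x : ZMod (p ^ c)) :
    castLE h₁ (castLE h₂ x) = castLE (h₁.trans h₂) x := by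
  change ((castLE h₁).comp (castLE (p := p) h₂)) x = _
  rw [castLE, castLE, ZMod.castHom_comp]

/-- **Functoriality of fibre sums**: summing the fibres of `ℤ/p^c → ℤ/p^b` and then of
`ℤ/p^b → ℤ/p^a` is summing the fibres of `ℤ/p^c → ℤ/p^a`. [cite: SerreGaloisCohomology1997, I §2.5] -/
theorem fiberSum_fiberSum {a b c : ℕ} (h₁ : a ≤ b) (h₂ : b ≤ c) (y : ZMod (p ^ c) → A) :
    fiberSum h₁ (fiberSum h₂ y) = fiberSum (h₁.trans h₂) y := by
  funext x
  simp only [fiberSum_apply]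
  -- exchange the sums; only `c' = castLE h₂ c''` contributes
  have key : ∀ c'' : ZMod (p ^ c),
      (∑ c' : ZMod (p ^ b), if castLE h₁ c' = x then (if castLE h₂ c'' = c' then y c'' else 0) else 0) =
        if castLE (h₁.trans h₂) c'' = x then y c'' else 0 := by
    intro c''
    rw [← castLE_castLE h₁ h₂]
    have : ∀ c' : ZMod (p ^ b),
        (if castLE h₁ c' = x then (if castLE h₂ c'' = c' then y c'' else 0) else 0) =
          if c' = castLE h₂ c'' then (if castLE h₁ (castLE h₂ c'') = x then y c'' else 0) else 0 := by
      intro c'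
      by_cases hc : c' = castLE h₂ c''
      · subst hc; simp
      · rw [if_neg hc]
        split_ifs with h1 h2
        · exact absurd h2.symm hc
        · rfl
        · rfl
    simp_rw [this]
    rw [sum_ite_eq' univ (castLE h₂ c''), if_pos (mem_univ _)]
  rw [← sum_congr rfl fun c'' _ => key c'']
  rw [sum_comm]
  refine sum_congr rfl fun c' _ => ?_
  split_ifs with h
  · rfl
  · simp

/-- **Fibre sums commute with translations**: `fiberSum h (c' ↦ y(c' − t))(c) = fiberSum h y (c − t̄)`.
[cite: SerreGaloisCohomology1997, I §2.5] -/
theorem fiberSum_sub_const {n m : ℕ} (h : n ≤ m) (y : ZMod (p ^ m) → A) (t : ZMod (p ^ m))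
    (c : ZMod (p ^ n)) :
    fiberSum h (fun c' => y (c' - t)) c = fiberSum h y (c - castLE h t) := by
  simp only [fiberSum_apply]
  rw [← Equiv.sum_comp (Equiv.addRight t)]
  refine sum_congr rfl fun c' _ => ?_
  simp only [Equiv.coe_addRight, add_sub_cancel_right, map_add]
  by_cases hc : castLE h c' = c - castLE h t
  · rw [if_pos hc, if_pos (by rw [hc, sub_add_cancel])]
  · rw [if_neg hc, if_neg (fun h' => hc (by rw [← h', add_sub_cancel_right]))]

/-- Fibre sums of a `Pi.single`: `fiberSum h (δ_{c₀} a) = δ_{c̄₀} a`. [cite: SerreGaloisCohomology1997, I §2.5] -/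
theorem fiberSum_single {n m : ℕ} (h : n ≤ m) (c₀ : ZMod (p ^ m)) (a : A) :
    fiberSum h (Pi.single c₀ a : ZMod (p ^ m) → A) = Pi.single (castLE h c₀) a := by
  classical
  funext c
  rw [fiberSum_apply]
  have : ∀ c' : ZMod (p ^ m),
      (if castLE h c' = c then (Pi.single c₀ a : ZMod (p ^ m) → A) c' else 0) =
        if c' = c₀ then (if castLE h c₀ = c then a else 0) else 0 := by
    intro c'
    by_cases hc : c' = c₀
    · subst hc; simp
    · rw [Pi.single_eq_of_ne hc, if_neg hc]; split_ifs <;> rfl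
  simp_rw [this]
  rw [sum_ite_eq' univ c₀, if_pos (mem_univ _)]
  by_cases hc : castLE h c₀ = c
  · rw [if_pos hc, hc, Pi.single_eq_same]
  · rw [if_neg hc, Pi.single_eq_of_ne (Ne.symm hc)]

/-- The total sum is preserved by fibre sums: `Σ_c fiberSum h y c = Σ_{c'} y c'`.
[cite: SerreGaloisCohomology1997, I §2.5] -/
theorem sum_fiberSum {n m : ℕ} (h : n ≤ m) (y : ZMod (p ^ m) → A) :
    ∑ c, fiberSum h y c = ∑ c', y c' := by
  simp only [fiberSum_apply]
  rw [sum_comm]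
  refine sum_congr rfl fun c' _ => ?_
  rw [sum_ite_eq univ (castLE h c'), if_pos (mem_univ _)]

end FiberSum

/-! ## The transition `W[p^{k'}] → W[p^k]`, `P ↦ p^{k'−k} P`, of the Tate tower -/

section Torsion

variable {F : Type*} [Field F] (W : WeierstrassCurve F) (p : ℕ)

/-- **The transition map of the Tate tower**: for `k ≤ k'`, `W[p^{k'}] → W[p^k]`, `P ↦ p^{k'−k} • P`
(Silverman *AEC* III.§7: "the inverse limit being taken with respect to the natural maps
`E[ℓ^{n+1}] →(ℓ) E[ℓ^n]`", iterated). [cite: SilvermanAEC2009, III.§7] -/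
def torsionPowReduce {k k' : ℕ} (h : k ≤ k') :
    geomTorsion W ((p : ℤ) ^ k') →+ geomTorsion W ((p : ℤ) ^ k) where
  toFun P := ⟨((p : ℤ) ^ (k' - k)) • (P : geomPoints W), by
    have hP : ((p : ℤ) ^ k') • (P : geomPoints W) = 0 := (Submodule.mem_torsionBy_iff _ _).1 P.2
    refine (Submodule.mem_torsionBy_iff _ _).2 ?_
    change ((p : ℤ) ^ k) • ((p : ℤ) ^ (k' - k)) • (P : geomPoints W) = 0
    rw [smul_smul, ← pow_add, Nat.add_sub_cancel' h, hP]⟩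
  map_zero' := Subtype.ext (by
    change ((p : ℤ) ^ (k' - k)) • ((0 : geomTorsion W ((p : ℤ) ^ k')) : geomPoints W) = 0
    rw [ZeroMemClass.coe_zero, smul_zero])
  map_add' P Q := Subtype.ext (by
    change ((p : ℤ) ^ (k' - k)) • ((P + Q : geomTorsion W ((p : ℤ) ^ k')) : geomPoints W) =
      ((p : ℤ) ^ (k' - k)) • (P : geomPoints W) + ((p : ℤ) ^ (k' - k)) • (Q : geomPoints W)
    rw [AddMemClass.coe_add, smul_add])

/-- Values of `torsionPowReduce` on points. [cite: SilvermanAEC2009, III.§7] -/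
@[simp] theorem coe_torsionPowReduce {k k' : ℕ} (h : k ≤ k') (P : geomTorsion W ((p : ℤ) ^ k')) :
    ((torsionPowReduce W p h P : geomTorsion W ((p : ℤ) ^ k)) : geomPoints W) =
      ((p : ℤ) ^ (k' - k)) • (P : geomPoints W) := rfl

/-- `torsionPowReduce` along `k ≤ k` is the identity. [cite: SilvermanAEC2009, III.§7] -/
@[simp] theorem torsionPowReduce_refl (k : ℕ) (P : geomTorsion W ((p : ℤ) ^ k)) :
    torsionPowReduce W p le_rfl P = P :=
  Subtype.ext (by rw [coe_torsionPowReduce, Nat.sub_self, pow_zero, one_smul])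

/-- `torsionPowReduce` is transitive. [cite: SilvermanAEC2009, III.§7] -/
theorem torsionPowReduce_trans {a b c : ℕ} (h₁ : a ≤ b) (h₂ : b ≤ c)
    (P : geomTorsion W ((p : ℤ) ^ c)) :
    torsionPowReduce W p h₁ (torsionPowReduce W p h₂ P) = torsionPowReduce W p (h₁.trans h₂) P :=
  Subtype.ext (by
    rw [coe_torsionPowReduce, coe_torsionPowReduce, coe_torsionPowReduce, smul_smul, ← pow_add,
      show b - a + (c - b) = c - a by omega])

/-- `torsionPowReduce` commutes with the Galois action. [cite: SilvermanAEC2009, III.§7] -/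
theorem torsionPowReduce_smul {k k' : ℕ} (h : k ≤ k') (σ : absoluteGaloisGroup F)
    (P : geomTorsion W ((p : ℤ) ^ k')) :
    torsionPowReduce W p h (σ • P) = σ • torsionPowReduce W p h P :=
  Subtype.ext (by
    rw [coe_torsionPowReduce, AddSubgroup.torsionBy.coe_smul, AddSubgroup.torsionBy.coe_smul,
      coe_torsionPowReduce]
    exact (map_zsmul (DistribSMul.toAddMonoidHom (geomPoints W) σ) _ (P : geomPoints W)).symm)

end Torsion

/-! ## The coefficient system `(ℤ/p^n → W[p^k])_{n,k}` and its limit `𝕋 = T_pW ⊗ Λ` -/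

section System

variable (W : WeierstrassCurve ℚ) (p : ℕ) [Fact p.Prime] (κ : ZpExtension ℚ p)

/-- The coefficient module at level `(n, k)`: `ℤ/p^n → W[p^k]`, i.e. `W[p^k] ⊗ ℤ[Gal(ℚ_n/ℚ)]` — the
carrier of the tree's `κ.twistGroupRing (W.torsionGaloisModule (p^k)) n` (Kato's
`T/p^k ⊗ ℤ/p^k[G_n]`, §13.8). [cite: Kato2004Asterisque, §13.8 (p. 228)] -/
abbrev Coeff (a : ℕ × ℕ) : Type := ZMod (p ^ a.1) → geomTorsion W ((p : ℤ) ^ a.2)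

/-- **The transition map `Coeff b → Coeff a`** for `a ≤ b` (product order on `ℕ × ℕ`): fibre sums
along `ℤ/p^{b.1} ↠ ℤ/p^{a.1}` followed by `P ↦ p^{b.2 − a.2} P` — the map
`T/p^{k'} ⊗ ℤ[G_{n'}] → T/p^k ⊗ ℤ[G_n]`. [cite: Kato2004Asterisque, §13.8 (p. 228)] -/
def red {a b : ℕ × ℕ} (h : a ≤ b) : Coeff W p b →+ Coeff W p a where
  toFun y c := torsionPowReduce W p h.2 (fiberSum h.1 y c)
  map_zero' := by funext c; rw [fiberSum_zero, Pi.zero_apply, map_zero, Pi.zero_apply]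
  map_add' y y' := by funext c; rw [fiberSum_add, Pi.add_apply, map_add, Pi.add_apply]

/-- Unfolding `red`. [cite: Kato2004Asterisque, §13.8 (p. 228)] -/
theorem red_apply {a b : ℕ × ℕ} (h : a ≤ b) (y : Coeff W p b) (c : ZMod (p ^ a.1)) :
    red W p h y c = torsionPowReduce W p h.2 (fiberSum h.1 y c) := rfl

/-- `red` along `a ≤ a` is the identity. [cite: Kato2004Asterisque, §13.8 (p. 228)] -/
theorem red_refl (a : ℕ × ℕ) (y : Coeff W p a) : red W p (le_refl a) y = y := by
  funext c
  rw [red_apply]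
  have h1 : fiberSum (le_refl a).1 y = y := fiberSum_refl a.1 y
  rw [h1]
  exact torsionPowReduce_refl W p a.2 (y c)

/-- `torsionPowReduce` commutes with fibre sums (it is additive). [cite: SilvermanAEC2009, III.§7] -/
theorem torsionPowReduce_fiberSum {n m k k' : ℕ} (hn : n ≤ m) (hk : k ≤ k')
    (y : ZMod (p ^ m) → geomTorsion W ((p : ℤ) ^ k')) (c : ZMod (p ^ n)) :
    torsionPowReduce W p hk (fiberSum hn y c) = fiberSum hn (fun c' => torsionPowReduce W p hk (y c')) c := by
  simp only [fiberSum_apply, map_sum]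
  refine sum_congr rfl fun c' _ => ?_
  split_ifs <;> simp

/-- `red` is transitive. [cite: Kato2004Asterisque, §13.8 (p. 228)] -/
theorem red_trans {a b c : ℕ × ℕ} (h₁ : a ≤ b) (h₂ : b ≤ c) (y : Coeff W p c) :
    red W p (h₁.trans h₂) y = red W p h₁ (red W p h₂ y) := by
  funext x
  simp only [red_apply]
  have : (fun x' => red W p h₂ y x') = fun x' => torsionPowReduce W p h₂.2 (fiberSum h₂.1 y x') := rfl
  rw [show fiberSum h₁.1 (red W p h₂ y) x =
      fiberSum h₁.1 (fun x' => torsionPowReduce W p h₂.2 (fiberSum h₂.1 y x')) x from rfl,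
    ← torsionPowReduce_fiberSum, torsionPowReduce_trans, fiberSum_fiberSum]

/-- **`red` is `Γ_ℚ`-equivariant** for the diagonal actions `(g·y)(c) = g·y(c − κ̄ g)` of
`twistGroupRing` (`κ̄_{n'}` reduces to `κ̄_n`, `cast_layerIndex`). [cite: Kato2004Asterisque, §13.8 (p. 228)] -/
theorem red_smul {a b : ℕ × ℕ} (h : a ≤ b) (g : absoluteGaloisGroup ℚ) (y : Coeff W p b) :
    red W p h (κ.twistGroupRing (W.torsionGaloisModule ((p : ℤ) ^ b.2)) b.1 g y) =
      κ.twistGroupRing (W.torsionGaloisModule ((p : ℤ) ^ a.2)) a.1 g (red W p h y) := by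
  funext c
  rw [red_apply, ZpExtension.twistGroupRing_apply, red_apply,
    WeierstrassCurve.torsionGaloisModule_apply_apply, ← torsionPowReduce_smul]
  congr 1
  have hy : (fun c' => κ.twistGroupRing (W.torsionGaloisModule ((p : ℤ) ^ b.2)) b.1 g y c') =
      fun c' => g • y (c' - κ.layerIndex b.1 g) := by
    funext c'
    rw [ZpExtension.twistGroupRing_apply, WeierstrassCurve.torsionGaloisModule_apply_apply]
  rw [show fiberSum h.1 (κ.twistGroupRing (W.torsionGaloisModule ((p : ℤ) ^ b.2)) b.1 g y) c =
      fiberSum h.1 (fun c' => g • y (c' - κ.layerIndex b.1 g)) c from by rw [← hy]]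
  have hcast : castLE h.1 (κ.layerIndex b.1 g) = κ.layerIndex a.1 g := by
    rw [castLE, ZMod.castHom_apply, ZpExtension.layerIndex, ZpExtension.layerIndex,
      PadicInt.cast_toZModPow a.1 b.1 h.1]
  rw [fiberSum_sub_const h.1 (fun c'' => g • y c'') (κ.layerIndex b.1 g) c, hcast]
  simp only [fiberSum_apply, smul_sum, smul_ite, smul_zero]

/-- **The inverse system `(W[p^k] ⊗ ℤ[Gal(ℚ_n/ℚ)])_{(n,k)}` of finite discrete `Γ_ℚ`-modules**
(product order on `ℕ × ℕ`; actions = the tree's `twistGroupRing`; transitions = `red`): Kato's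
`T/p^k ⊗ O_λ[G_n]`, `T = T_pW`, whose limit is `T ⊗ Λ` (§13.8, p. 228).
[cite: Kato2004Asterisque, §13.8 (p. 228)] -/
def system : DiscreteInvSystem (absoluteGaloisGroup ℚ) (Coeff W p) where
  le a b := a ≤ b
  le_refl := le_refl
  le_trans h₁ h₂ := h₁.trans h₂
  ρ a := κ.twistGroupRing (W.torsionGaloisModule ((p : ℤ) ^ a.2)) a.1
  red h := red W p h
  red_smul h g y := red_smul W p κ h g y
  red_refl := red_refl W p
  red_trans h₁ h₂ y := red_trans W p h₁ h₂ y

/-- The order relation of `system` is the product order of `ℕ × ℕ`. [cite: Kato2004Asterisque, §13.8 (p. 228)] -/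
@[simp] theorem system_le (a b : ℕ × ℕ) : (system W p κ).le a b ↔ a ≤ b := Iff.rfl

/-- The actions of `system` are the tree's `twistGroupRing`. [cite: Kato2004Asterisque, §13.8 (p. 228)] -/
@[simp] theorem system_ρ (a : ℕ × ℕ) :
    (system W p κ).ρ a = κ.twistGroupRing (W.torsionGaloisModule ((p : ℤ) ^ a.2)) a.1 := rfl

/-- The transitions of `system` are `red`. [cite: Kato2004Asterisque, §13.8 (p. 228)] -/
@[simp] theorem system_red {a b : ℕ × ℕ} (h : a ≤ b) (y : Coeff W p b) :
    (system W p κ).red h y = red W p h y := rfl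

/-- The diagonal `i ↦ (i, i)` is a cofinal chain of `ℕ × ℕ`. [cite: Kato2004Asterisque, §13.8 (p. 228)] -/
def diagonalChain : (system W p κ).CofinalChain where
  seq i := (i, i)
  le_succ i := ⟨Nat.le_succ i, Nat.le_succ i⟩
  cofinal a := ⟨max a.1 a.2, ⟨le_max_left _ _, le_max_right _ _⟩⟩

/-- **The same inverse system as a system of `H`-modules** for a subgroup `H ≤ Γ_ℚ` (actions
restricted along `H ↪ Γ_ℚ`; same modules, same transitions, same limit): the shape in which the
tree's comparison `H¹_cont(H, lim) ≅ lim H¹(H, ·)` (`DiscreteInvSystem.continuousCohomologyOneLimitEquiv`)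
is applied to `H = Γ_0` and to the inertia subgroups `Γ_n ⊓ I_𝔓`. [cite: Kato2004Asterisque, §13.8 (p. 228)] -/
def systemOn (H : Subgroup (absoluteGaloisGroup ℚ)) : DiscreteInvSystem H (Coeff W p) where
  le a b := a ≤ b
  le_refl := le_refl
  le_trans h₁ h₂ := h₁.trans h₂
  ρ a := ((system W p κ).ρ a).restrict
    (Literature.NumberTheory.GaloisRepresentations.subgroupIncl H)
  red h := red W p h
  red_smul h g y := red_smul W p κ h (g : absoluteGaloisGroup ℚ) y
  red_refl := red_refl W p
  red_trans h₁ h₂ y := red_trans W p h₁ h₂ y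

/-- `systemOn H` has the same limit group as `system`. [cite: Kato2004Asterisque, §13.8 (p. 228)] -/
theorem systemOn_limit (H : Subgroup (absoluteGaloisGroup ℚ)) :
    (systemOn W p κ H).limit = (system W p κ).limit := rfl

/-- The limit representation of `systemOn H` IS the restriction to `H` of the limit representation of
`system`, as objects of Mathlib's `TopRep ℤ H` (definitionally). [cite: Kato2004Asterisque, §13.8 (p. 228)] -/
theorem systemOn_limitRep_toTopRep (H : Subgroup (absoluteGaloisGroup ℚ)) :
    (systemOn W p κ H).limitRep.toTopRep = subgroupRep (system W p κ).limitRep.toTopRep H := rfl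

/-- The levels of `systemOn H` are the restrictions of the levels of `system`, as objects of
`TopRep ℤ H` (definitionally). [cite: Kato2004Asterisque, §13.8 (p. 228)] -/
theorem systemOn_ρ_toTopRep (H : Subgroup (absoluteGaloisGroup ℚ)) (a : ℕ × ℕ) :
    ((systemOn W p κ H).ρ a).toTopRep = subgroupRep ((system W p κ).ρ a).toTopRep H := rfl

/-- The diagonal cofinal chain of `systemOn H`. [cite: Kato2004Asterisque, §13.8 (p. 228)] -/
def diagonalChainOn (H : Subgroup (absoluteGaloisGroup ℚ)) : (systemOn W p κ H).CofinalChain where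
  seq i := (i, i)
  le_succ i := ⟨Nat.le_succ i, Nat.le_succ i⟩
  cofinal a := ⟨max a.1 a.2, ⟨le_max_left _ _, le_max_right _ _⟩⟩

/-! ### The shift `y ↦ y(· + 1)` (multiplication by `γ`) -/

/-- Translation of the group-ring coordinate: `(shiftCoeff y)(c) = y(c + 1)` — multiplication by the
generator `γ̄ = 1` of `ℤ/p^n = Gal(ℚ_n/ℚ)` on `W[p^k] ⊗ ℤ[Gal(ℚ_n/ℚ)]`.
[cite: Kato2004Asterisque, §14.14 (p. 243)] -/
def shiftCoeff (a : ℕ × ℕ) : Coeff W p a →+ Coeff W p a where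
  toFun y c := y (c + 1)
  map_zero' := rfl
  map_add' _ _ := rfl

omit [Fact p.Prime] in
/-- Unfolding `shiftCoeff`. [cite: Kato2004Asterisque, §14.14 (p. 243)] -/
@[simp] theorem shiftCoeff_apply (a : ℕ × ℕ) (y : Coeff W p a) (c : ZMod (p ^ a.1)) :
    shiftCoeff W p a y c = y (c + 1) := rfl

/-- The shift commutes with the transition maps. [cite: Kato2004Asterisque, §14.14 (p. 243)] -/
theorem red_shiftCoeff {a b : ℕ × ℕ} (h : a ≤ b) (y : Coeff W p b) :
    red W p h (shiftCoeff W p b y) = shiftCoeff W p a (red W p h y) := by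
  funext c
  rw [red_apply, shiftCoeff_apply, red_apply]
  congr 1
  have h1 : (shiftCoeff W p b y : ZMod (p ^ b.1) → _) = fun c' => y (c' - (-1)) := by
    funext c'; rw [shiftCoeff_apply, sub_neg_eq_add]
  rw [h1, fiberSum_sub_const, map_neg, map_one, sub_neg_eq_add]

/-- The shift commutes with the diagonal Galois action. [cite: Kato2004Asterisque, §14.14 (p. 243)] -/
theorem shiftCoeff_smul (a : ℕ × ℕ) (g : absoluteGaloisGroup ℚ) (y : Coeff W p a) :
    shiftCoeff W p a ((system W p κ).ρ a g y) = (system W p κ).ρ a g (shiftCoeff W p a y) := by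
  funext c
  simp only [shiftCoeff_apply, system_ρ, ZpExtension.twistGroupRing_apply]
  congr 2
  abel

/-- **The shift on the limit `𝕋`** (coordinatewise `shiftCoeff`): multiplication by `γ` on
`T ⊗ Λ`. [cite: Kato2004Asterisque, §14.14 (p. 243)] -/
def shift : (system W p κ).limit →+ (system W p κ).limit where
  toFun μ := ⟨fun a => shiftCoeff W p a ((μ : ∀ a, Coeff W p a) a), fun a b h => by
    rw [system_red, red_shiftCoeff, ← system_red W p κ h, (system W p κ).red_apply_coe μ h]⟩
  map_zero' := Subtype.ext (funext fun a => by simp)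
  map_add' μ ν := Subtype.ext (funext fun a => by simp)

/-- Coordinates of the shift. [cite: Kato2004Asterisque, §14.14 (p. 243)] -/
@[simp] theorem coe_shift_apply (μ : (system W p κ).limit) (a : ℕ × ℕ) :
    (shift W p κ μ : ∀ a, Coeff W p a) a = shiftCoeff W p a ((μ : ∀ a, Coeff W p a) a) := rfl

/-- The shift is continuous (coordinatewise; the limit has the subspace topology of the product).
[cite: Kato2004Asterisque, §14.14 (p. 243)] -/
theorem continuous_shift : Continuous (shift W p κ) := by
  refine continuous_induced_rng.2 (continuous_pi fun a => continuous_pi fun c => ?_)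
  change Continuous fun μ : (system W p κ).limit => (μ : ∀ a, Coeff W p a) a (c + 1)
  exact ((continuous_apply (A := fun _ : ZMod (p ^ a.1) => geomTorsion W ((p : ℤ) ^ a.2))
    (c + 1)).comp ((continuous_apply (A := Coeff W p) a).comp continuous_subtype_val))

/-- The shift is `Γ_ℚ`-equivariant. [cite: Kato2004Asterisque, §14.14 (p. 243)] -/
theorem shift_smul (g : absoluteGaloisGroup ℚ) (μ : (system W p κ).limit) :
    shift W p κ ((system W p κ).limitRep g μ) = (system W p κ).limitRep g (shift W p κ μ) :=
  Subtype.ext (funext fun a => by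
    rw [coe_shift_apply, DiscreteInvSystem.coe_limitRep_apply, shiftCoeff_smul,
      DiscreteInvSystem.coe_limitRep_apply, coe_shift_apply])

/-! ### The projections to the Tate module and the unit section -/

omit [Fact p.Prime] in
/-- Iterated tower relation in `T_pW`: `p^j • a_{k+j} = a_k` on points (from `TateModule.smul_proj_succ`).
[cite: SilvermanAEC2009, III.§7] -/
theorem pow_smul_proj_add (a : W.tateModule p) (k j : ℕ) :
    ((p : ℤ) ^ j) • TateModule.proj p (k + j) a = TateModule.proj p k a := by
  induction j with
  | zero => simp
  | succ j ih =>
    rw [pow_succ, mul_smul, ← Nat.add_assoc, natCast_zsmul, TateModule.smul_proj_succ, ih]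

/-- The coordinates `(μ_{n,k}(0))_k` of an element of the limit form an element of the Tate module.
[cite: Kato2004Asterisque, §13.8 (p. 228)] -/
theorem coord_zero_mem_tateSubgroup (n : ℕ) (μ : (system W p κ).limit) :
    (fun k => (((μ : ∀ a, Coeff W p a) (n, k) 0 : geomTorsion W ((p : ℤ) ^ k)) : geomPoints W)) ∈
      tateSubgroup (geomPoints W) p := by
  refine ⟨fun k => ?_, fun k => ?_⟩
  · have h : ((p : ℤ) ^ k) • ((((μ : ∀ a, Coeff W p a) (n, k) 0 : geomTorsion W ((p : ℤ) ^ k)) :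
        geomPoints W)) = 0 :=
      (Submodule.mem_torsionBy_iff _ _).1 ((μ : ∀ a, Coeff W p a) (n, k) 0).2
    rw [← natCast_zsmul]
    push_cast
    exact h
  · have hle : ((n, k) : ℕ × ℕ) ≤ (n, k + 1) := ⟨le_rfl, Nat.le_succ k⟩
    have h := congrFun ((system W p κ).red_apply_coe μ (show (system W p κ).le (n, k) (n, k + 1) from hle)) 0
    rw [system_red, red_apply] at h
    have h' := congrArg (fun P : geomTorsion W ((p : ℤ) ^ k) => (P : geomPoints W)) h
    dsimp only at h'
    rw [coe_torsionPowReduce, fiberSum_refl, Nat.add_sub_cancel_left, pow_one] at h'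
    rw [← natCast_zsmul]
    exact h'

/-- **The projection `toTate n : 𝕋 → T_pW`, `μ ↦ (μ_{n,k}(0))_k`** — evaluation of the `n`-th
group-ring component at the identity coset `0 ∈ ℤ/p^n` (Shapiro's `f ↦ f(1)` on
`Maps_{Γ_n}(Γ_ℚ, T)`); `toTate 0` is the augmentation `T ⊗ Λ → T`.
[cite: Kato2004Asterisque, §13.8 (p. 228) and §14.14 (p. 243)] -/
def toTate (n : ℕ) : (system W p κ).limit →+ W.tateModule p where
  toFun μ := TateModule.mk _ (coord_zero_mem_tateSubgroup W p κ n μ).1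
    (coord_zero_mem_tateSubgroup W p κ n μ).2
  map_zero' := TateModule.ext fun k => by simp [TateModule.proj_mk]
  map_add' μ ν := TateModule.ext fun k => by
    simp only [TateModule.proj_mk, map_add]
    rfl

/-- Components of `toTate`: `proj_k (toTate n μ) = μ_{n,k}(0)`. [cite: Kato2004Asterisque, §13.8 (p. 228)] -/
@[simp] theorem proj_toTate (n k : ℕ) (μ : (system W p κ).limit) :
    TateModule.proj p k (toTate W p κ n μ) =
      (((μ : ∀ a, Coeff W p a) (n, k) 0 : geomTorsion W ((p : ℤ) ^ k)) : geomPoints W) := rfl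

/-- `tateModPk ∘ toTate n` is evaluation at `0` of the `(n,k)`-component.
[cite: Kato2004Asterisque, §13.8 (p. 228)] -/
theorem tateModPk_toTate (n k : ℕ) (μ : (system W p κ).limit) :
    tateModPk W p k (toTate W p κ n μ) = (μ : ∀ a, Coeff W p a) (n, k) 0 :=
  Subtype.ext (by rw [coe_tateModPk_apply, proj_toTate])

/-- `toTate n` is continuous. [cite: Kato2004Asterisque, §13.8 (p. 228)] -/
theorem continuous_toTate (n : ℕ) : Continuous (toTate W p κ n) := by
  refine continuous_induced_rng.2 (continuous_pi fun k => ?_)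
  change Continuous fun μ : (system W p κ).limit =>
    (((μ : ∀ a, Coeff W p a) (n, k) 0 : geomTorsion W ((p : ℤ) ^ k)) : geomPoints W)
  exact continuous_subtype_val.comp
    (((continuous_apply (A := fun _ : ZMod (p ^ n) => geomTorsion W ((p : ℤ) ^ k)) 0).comp
      ((continuous_apply (A := Coeff W p) ((n, k) : ℕ × ℕ)).comp continuous_subtype_val)))

/-- **`toTate n` is `Γ_n`-equivariant**: for `g ∈ Γ_n = κ.layerSubgroup n` (so `κ̄_n(g) = 0`),
`toTate n (g · μ) = g · toTate n μ`. [cite: Kato2004Asterisque, §13.8 (p. 228)] -/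
theorem toTate_smul_of_mem (n : ℕ) {g : absoluteGaloisGroup ℚ} (hg : g ∈ κ.layerSubgroup n)
    (μ : (system W p κ).limit) :
    toTate W p κ n ((system W p κ).limitRep g μ) = g • toTate W p κ n μ := by
  refine TateModule.ext fun k => ?_
  rw [proj_toTate, TateModule.proj_smul_of_distribMulAction, proj_toTate,
    DiscreteInvSystem.coe_limitRep_apply, system_ρ, ZpExtension.twistGroupRing_apply,
    (κ.layerIndex_eq_zero_iff n g).2 hg, sub_zero, WeierstrassCurve.torsionGaloisModule_apply_apply,
    AddSubgroup.torsionBy.coe_smul]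

/-- The family `(a_k · δ_0)_{n,k}` attached to `a ∈ T_pW` is compatible with the transition maps.
[cite: Kato2004Asterisque, §14.14 (p. 243)] -/
theorem single_tateModPk_mem_limit (a : W.tateModule p) :
    (fun b : ℕ × ℕ => (Pi.single (0 : ZMod (p ^ b.1)) (tateModPk W p b.2 a) : Coeff W p b)) ∈
      (system W p κ).limit := by
  classical
  intro b b' h
  have h' : b ≤ b' := h
  change red W p h' (Pi.single 0 (tateModPk W p b'.2 a)) = Pi.single 0 (tateModPk W p b.2 a)
  funext c
  rw [red_apply, fiberSum_single h'.1 0, map_zero]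
  by_cases hc : c = 0
  · subst hc
    rw [Pi.single_eq_same, Pi.single_eq_same]
    refine Subtype.ext ?_
    rw [coe_torsionPowReduce, coe_tateModPk_apply, coe_tateModPk_apply]
    have := pow_smul_proj_add W p a b.2 (b'.2 - b.2)
    rwa [Nat.add_sub_cancel' h'.2] at this
  · rw [Pi.single_eq_of_ne hc, Pi.single_eq_of_ne hc, map_zero]

/-- **The unit section `ofTate : T_pW → 𝕋`, `a ↦ (a_k · δ_0)_{n,k}`** (`δ_0` = the identity coset):
the section `t ↦ t ⊗ 1` of the augmentation. [cite: Kato2004Asterisque, §14.14 (p. 243)] -/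
def ofTate : W.tateModule p →+ (system W p κ).limit where
  toFun a := ⟨_, single_tateModPk_mem_limit W p κ a⟩
  map_zero' := by
    classical
    exact Subtype.ext (funext fun b => by simp)
  map_add' a a' := by
    classical
    exact Subtype.ext (funext fun b => by simp [Pi.single_add])

/-- Coordinates of `ofTate`. [cite: Kato2004Asterisque, §14.14 (p. 243)] -/
theorem coe_ofTate_apply (a : W.tateModule p) (b : ℕ × ℕ) :
    (ofTate W p κ a : ∀ b, Coeff W p b) b =
      (by classical exact Pi.single (0 : ZMod (p ^ b.1)) (tateModPk W p b.2 a)) := rfl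

/-- `toTate n ∘ ofTate = id`. [cite: Kato2004Asterisque, §14.14 (p. 243)] -/
theorem toTate_ofTate (n : ℕ) (a : W.tateModule p) : toTate W p κ n (ofTate W p κ a) = a := by
  classical
  refine TateModule.ext fun k => ?_
  rw [proj_toTate, coe_ofTate_apply]
  change ((Pi.single (0 : ZMod (p ^ n)) (tateModPk W p k a) : Coeff W p (n, k)) 0 : geomPoints W) = _
  rw [Pi.single_eq_same, coe_tateModPk_apply]

end System

end TwistTate

end Literature.NumberTheory.EllipticCurves.Kato2004

end
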